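import Literature.Computability.MetaComplexity.KDNFResolution
import Literature.Computability.MetaComplexity.ResolutionWidth
import Summits.PneNP.PneNP.Theorems.ExpanderLinearGeneratorsResKTrees
import Summits.PneNP.PneNP.Theorems.ExpanderLinearGeneratorsResKPaths
import HarnessLib

/-!
# The `Res(k)` rung for expanding linear systems, IV: shallow trees give narrow refutations

Support file for `stmt-PneNP-11443`. The Segerlind–Buss–Impagliazzo conversion: if, under a
partial assignment `ρ`, EVERY line of an `R(k)`-refutation of a CNF `φ` has a strong decision tree
of height at most `H` (`Ev L ρ H` of file III), then the restricted clause set `φ|ρ` has a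
resolution refutation of width at most `3H` (`resDerivable_empty_of_forall_ev`).

The invariant (`pathClause_derivable`): for every line `L` and every PATH `p` (file IVa) of at most
`H` literals such that `ρ ∪ p` falsifies every consistent term of `L`, the clause `¬p` is derivable
from `φ|ρ` in width `3H`. A line inferred from premises `L₁, L₂` is handled by walking the strong
trees of `L₁` and then `L₂` below `ρ ∪ p` (`walk`): at `0`-leaves the invariant of the premise
applies, two `1`-leaves contradict the soundness of the rule (`dnfEval_of_justifies_local`), and
query nodes become resolution steps.

[Segerlind–Buss–Impagliazzo 2004, §5 (Thm. 5.1: converting `Res(k)` refutations with shallow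
decision trees into narrow resolution refutations); Alekhnovich 2011, §4]
-/

namespace Summit.PneNP.PneNP.Theorems.ResKRestriction

open Finset Literature.Computability.Complexity Literature.Computability.MetaComplexity

/-! ### Paths and extensions -/

/-- `ρ` is extended by `ext ρ p`. [folklore] -/
theorem extends_ext (ρ : ℕ → Option Bool) (p : Finset (Literal ℕ)) : Extends ρ (ext ρ p) :=
  fun _ _ hx => ext_of_some p hx

/-- A larger path gives an extension. [folklore] -/
theorem IsPath.extends_of_subset {ρ : ℕ → Option Bool} {p q : Finset (Literal ℕ)} (hq : IsPath ρ q)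
    (hpq : p ⊆ q) : Extends (ext ρ p) (ext ρ q) := by
  intro x b hx
  cases hρ : ρ x with
  | some b' => rw [ext_of_some p hρ] at hx; rw [ext_of_some q hρ]; exact hx
  | none =>
    rw [ext_of_none p hρ] at hx
    have := mem_of_pval_eq hx
    exact hq.ext_eq (hpq this)

/-! ### Total extensions and local soundness of the `R(k)` rules -/

/-- The total assignment extending a partial one by `false`. [folklore] -/
def total (α : ℕ → Option Bool) : ℕ → Bool :=
  fun x => (α x).getD false

/-- A term satisfied by `α` is true under `total α`. [folklore] -/
theorem termEval_total_of_satBy {α : ℕ → Option Bool} {t : Finset (Literal ℕ)} (h : SatBy α t) :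
    termEval (total α) t := by
  intro l hl
  simp [Literal.eval, total, h l hl]

/-- A term falsified by `α` is false under `total α`. [folklore] -/
theorem not_termEval_total_of_falsBy {α : ℕ → Option Bool} {t : Finset (Literal ℕ)}
    (h : FalsBy α t) : ¬ termEval (total α) t := by
  obtain ⟨l, hl, hαl⟩ := h
  intro ht
  have := ht l hl
  simp [Literal.eval, total, hαl] at this

/-- An inconsistent term is false under every total assignment. [folklore] -/
theorem not_termEval_of_not_tconsistent {σ : ℕ → Bool} {t : Finset (Literal ℕ)}
    (h : ¬ TConsistent t) : ¬ termEval σ t := by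
  intro ht
  unfold TConsistent at h
  push Not at h
  obtain ⟨l, hl, hneg⟩ := h
  have h1 := ht l hl
  have h2 := ht _ hneg
  rw [Literal.eval_negate, h1] at h2
  simp at h2

/-- If `α` falsifies every consistent term of `D`, then `D` is false under `total α`. [folklore] -/
theorem not_dnfEval_total {α : ℕ → Option Bool} {D : Finset (Finset (Literal ℕ))}
    (h : ∀ t ∈ D, TConsistent t → FalsBy α t) : ¬ dnfEval (total α) D := by
  rintro ⟨t, ht, htt⟩
  by_cases hc : TConsistent t
  · exact not_termEval_total_of_falsBy (h t ht hc) htt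
  · exact not_termEval_of_not_tconsistent hc htt

/-- **Local soundness of the inference rules of `R(k)`**: a non-initial line is true under any
assignment making its PREMISES true (the tree's `dnfEval_of_justifies` asks for all earlier lines;
the proof is the same case analysis). [Krajíček 2019, L. 5.7.1; Ben-Sasson–Nordström 2009, Def. 2.1]
[cite: KrajicekProofComplexity2019, Lemma 5.7.1] -/
theorem dnfEval_of_justifies_local {φ : CNF ℕ} {prev : List (ResKLine ℕ)}
    {D : Finset (Finset (Literal ℕ))} {r : ResKRule} (hr : r.Justifies φ prev D)
    (hinit : r ≠ .initial) {σ : ℕ → Bool}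
    (hprev : ∀ i ∈ r.premises, ∀ (hi : i < prev.length), dnfEval σ (prev[i]'hi).dnf) :
    dnfEval σ D := by
  cases r with
  | initial => exact absurd rfl hinit
  | cut i j =>
    obtain ⟨hi, hj, B, C, T, -, hBi, hCj, rfl⟩ := hr
    have h1 := hprev i (by simp [ResKRule.premises]) hi
    have h2 := hprev j (by simp [ResKRule.premises]) hj
    rw [hBi] at h1
    rw [hCj] at h2
    obtain ⟨S, hS, hSt⟩ := h1
    rcases Finset.mem_insert.1 hS with rfl | hSB
    · obtain ⟨S', hS', hS't⟩ := h2
      rcases Finset.mem_union.1 hS' with hS'C | hS'n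
      · exact ⟨S', Finset.mem_union_right _ hS'C, hS't⟩
      · obtain ⟨a, haT, rfl⟩ := mem_negTerm.1 hS'n
        have ha := hSt a haT
        have hna := hS't a.negate (Finset.mem_singleton_self _)
        rw [Literal.eval_negate, ha] at hna
        simp at hna
    · exact ⟨S, Finset.mem_union_left _ hSB, hSt⟩
  | andIntro i j =>
    obtain ⟨hi, hj, A, T, T', hAi, hAj, rfl⟩ := hr
    have h1 := hprev i (by simp [ResKRule.premises]) hi
    have h2 := hprev j (by simp [ResKRule.premises]) hj
    rw [hAi] at h1
    rw [hAj] at h2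
    obtain ⟨S, hS, hSt⟩ := h1
    rcases Finset.mem_insert.1 hS with rfl | hSA
    · obtain ⟨S', hS', hS't⟩ := h2
      rcases Finset.mem_insert.1 hS' with rfl | hS'A
      · refine ⟨S ∪ S', Finset.mem_insert_self _ _, fun l hl => ?_⟩
        rcases Finset.mem_union.1 hl with hl | hl
        exacts [hSt l hl, hS't l hl]
      · exact ⟨S', Finset.mem_insert_of_mem hS'A, hS't⟩
    · exact ⟨S, Finset.mem_insert_of_mem hSA, hSt⟩
  | andElim i =>
    obtain ⟨hi, A, T, T', hT'T, hAi, rfl⟩ := hr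
    have h1 := hprev i (by simp [ResKRule.premises]) hi
    rw [hAi] at h1
    obtain ⟨S, hS, hSt⟩ := h1
    rcases Finset.mem_insert.1 hS with rfl | hSA
    · exact ⟨T', Finset.mem_insert_self _ _, fun l hl => hSt l (hT'T hl)⟩
    · exact ⟨S, Finset.mem_insert_of_mem hSA, hSt⟩
  | weaken i =>
    obtain ⟨hi, hsub⟩ := hr
    obtain ⟨S, hS, hSt⟩ := hprev i (by simp [ResKRule.premises]) hi
    exact ⟨S, hsub hS, hSt⟩

/-! ### Walking a strong tree below a path -/

section Walk

variable (Fax : Set (Finset (Literal ℕ))) (ρ : ℕ → Option Bool) (L : Finset (Finset (Literal ℕ)))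
  (H W B : ℕ)

/-- **Walking a strong tree.** Suppose the invariant holds for the DNF `L` (every path of size
`≤ H` falsifying all consistent terms of `L` has `¬path` derivable in width `W`), and a
continuation handles `1`-leaves (every path `q ⊇ p` of size `≤ B` satisfying a term of `L` has
`¬q` derivable). Then walking a strong tree of `L` of height `h` from the sub-path `τ ⊆ p`
(`|τ| + h ≤ H`, `|p| + h ≤ B ≤ W`) derives `¬p`. [Segerlind–Buss–Impagliazzo 2004, §5] [folklore] -/
theorem walk (hBW : B ≤ W)
    (Z : ∀ τ, IsPath ρ τ → τ.card ≤ H → (∀ t ∈ L, TConsistent t → FalsBy (ext ρ τ) t) →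
      ResDerivable Fax W (negPath τ))
    {p : Finset (Literal ℕ)} (hp : IsPath ρ p)
    (K : ∀ q, IsPath ρ q → p ⊆ q → q.card ≤ B → (∃ t ∈ L, SatBy (ext ρ q) t) →
      ResDerivable Fax W (negPath q))
    {h : ℕ} {τ : Finset (Literal ℕ)} (hτp : τ ⊆ p) (hτH : τ.card + h ≤ H) (hpB : p.card + h ≤ B)
    (hev : Ev L (ext ρ τ) h) : ResDerivable Fax W (negPath p) := by
  generalize hα : ext ρ τ = α at hev
  induction hev generalizing τ p with
  | one t ht hs =>
    subst hα
    exact K p hp subset_rfl (by omega) ⟨t, ht, hs.mono (hp.extends_of_subset hτp)⟩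
  | zero hf =>
    subst hα
    have hτ : IsPath ρ τ := ⟨fun l hl => hp.free l (hτp hl), fun l hl hneg => hp.cons l (hτp hl) (hτp hneg)⟩
    exact (Z τ hτ (by omega) hf).weaken (negPath_mono hτp) (by rw [card_negPath]; omega)
  | @query α h x hx _ _ ih0 ih1 =>
    subst hα
    have hτ : IsPath ρ τ := ⟨fun l hl => hp.free l (hτp hl), fun l hl hneg => hp.cons l (hτp hl) (hτp hneg)⟩
    -- the derivation's branches are the extensions of `τ` by `(x, b)`
    have hbr : ∀ b : Bool, ext ρ (insert (x, b) τ) = Function.update (ext ρ τ) x (some b) :=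
      fun b => ext_insert hτ hx b
    cases hpx : ext ρ p x with
    | some b =>
      -- `p` already decides `x`: follow that branch
      have hxb : (x, b) ∈ p := by
        have hρx : ρ x = none := by
          cases hρ : ρ x with
          | none => rfl
          | some b' => rw [ext_of_some τ hρ] at hx; exact absurd hx (by simp)
        rw [ext_of_none p hρx] at hpx
        exact mem_of_pval_eq hpx
      have hsub : insert (x, b) τ ⊆ p := Finset.insert_subset hxb hτp
      have hcard : (insert (x, b) τ).card + h ≤ H := by
        have := Finset.card_insert_le (x, b) τ; omega
      cases b with
      | false => exact ih0 hp K hsub hcard (by omega) (hbr false)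
      | true => exact ih1 hp K hsub hcard (by omega) (hbr true)
    | none =>
      -- branch on `x` and resolve
      have hder : ∀ b : Bool, ResDerivable Fax W (negPath (insert (x, b) p)) := by
        intro b
        have hp' : IsPath ρ (insert (x, b) p) := hp.insert hpx b
        have hsub : insert (x, b) τ ⊆ insert (x, b) p := Finset.insert_subset_insert _ hτp
        have hcard : (insert (x, b) τ).card + h ≤ H := by
          have := Finset.card_insert_le (x, b) τ; omega
        have hcardp : (insert (x, b) p).card + h ≤ B := by
          have := Finset.card_insert_le (x, b) p; omega
        have K' : ∀ q, IsPath ρ q → insert (x, b) p ⊆ q → q.card ≤ B →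
            (∃ t ∈ L, SatBy (ext ρ q) t) → ResDerivable Fax W (negPath q) :=
          fun q hq hpq hqB hsat => K q hq ((Finset.subset_insert _ _).trans hpq) hqB hsat
        cases b with
        | false => exact ih0 hp' K' hsub hcard hcardp (hbr false)
        | true => exact ih1 hp' K' hsub hcard hcardp (hbr true)
      have h0 := hder false
      have h1 := hder true
      rw [negPath_insert] at h0 h1
      refine ResDerivable.res h0 h1 (Finset.mem_insert_self _ _) (by simp)
        ?_ (by rw [card_negPath]; omega)
      intro l hl
      simp only [Bool.not_false, Bool.not_true, Finset.mem_union, Finset.mem_erase,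
        Finset.mem_insert] at hl
      rcases hl with ⟨hne, rfl | hl⟩ | ⟨hne, rfl | hl⟩
      · exact absurd rfl hne
      · exact hl
      · exact absurd rfl hne
      · exact hl

end Walk

/-! ### The invariant along an `R(k)`-derivation -/

/-- **The path-clause invariant.** If every line of an `R(k)`-derivation from `φ` has a strong
decision tree of height `≤ H` under `ρ`, then for every line `L` and every path `p` of size `≤ H`
under which every consistent term of `L` is falsified, the clause `¬p` is derivable from `φ|ρ` in
width `3H`. [Segerlind–Buss–Impagliazzo 2004, §5, Thm. 5.1] [folklore] -/
theorem pathClause_derivable {k : ℕ} {φ : CNF ℕ} {π : List (ResKLine ℕ)}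
    (hπ : IsResKDerivation k φ π) (ρ : ℕ → Option Bool) {H : ℕ}
    (hev : ∀ L ∈ π, Ev L.dnf ρ H) :
    ∀ (j : ℕ) (hj : j < π.length) (p : Finset (Literal ℕ)), IsPath ρ p → p.card ≤ H →
      (∀ t ∈ (π[j]'hj).dnf, TConsistent t → FalsBy (ext ρ p) t) →
      ResDerivable (restrictFormula ρ (clauseSet φ)) (3 * H) (negPath p) := by
  intro j
  induction j using Nat.strong_induction_on with
  | _ j ih =>
    intro hj p hp hpH hfals
    obtain ⟨-, hjust⟩ := hπ j hj
    set Fax := restrictFormula ρ (clauseSet φ)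
    -- premises of line `j` are earlier lines, with the invariant and strong trees
    have hprem : ∀ i (hi : i < (π.take j).length),
        (∀ τ, IsPath ρ τ → τ.card ≤ H →
          (∀ t ∈ ((π.take j)[i]'hi).dnf, TConsistent t → FalsBy (ext ρ τ) t) →
          ResDerivable Fax (3 * H) (negPath τ)) ∧ Ev ((π.take j)[i]'hi).dnf (ext ρ ∅) H := by
      intro i hi
      rw [List.length_take] at hi
      have hij : i < j := (lt_min_iff.1 hi).1
      have hi' : i < π.length := (lt_min_iff.1 hi).2
      rw [List.getElem_take]
      exact ⟨ih i hij hi', by rw [ext_empty]; exact hev _ (List.getElem_mem hi')⟩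
    -- case analysis on the rule
    by_cases hinit : (π[j]'hj).rule = .initial
    · -- axiom download: the restricted clause is contained in `¬p`
      rw [hinit] at hjust
      obtain ⟨C, hC, hD⟩ := hjust
      have hlit : ∀ l ∈ C, ext ρ p l.1 = some (!l.2) := by
        intro l hl
        obtain ⟨l', hl', h'⟩ := hfals {l} (by rw [hD]; exact mem_dnfOfClause.2 ⟨l, hl, rfl⟩)
          (by intro a ha hneg; rw [Finset.mem_singleton] at ha hneg; subst ha
              rcases a with ⟨x, b⟩; simp [Literal.negate] at hneg)
        rw [Finset.mem_singleton] at hl'; subst hl'; exact h'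
      have hns : ¬ SatisfiedBy ρ C := by
        rintro ⟨l, hl, hρl⟩
        have := hlit l hl
        rw [ext_of_some p hρl] at this
        cases hb : l.2 <;> simp [hb] at this
      refine ResDerivable.ax (restrictClause_mem_restrictFormula (F := clauseSet φ)
        (show C ∈ clauseSet φ from hC) hns) ?_ (by rw [card_negPath]; omega)
      · intro l hl
        rw [mem_restrictClause] at hl
        obtain ⟨hlC, hρl⟩ := hl
        have := hlit l hlC
        rw [ext_of_none p hρl] at this
        have hmem := mem_of_pval_eq this
        exact mem_negPath.2 (by simpa [Literal.negate] using hmem)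
    · -- an inference: walk the premises' trees below `p`
      -- generic contradiction at two `1`-leaves (or one, for unary rules)
      have hsound : ∀ q, IsPath ρ q → p ⊆ q →
          (∀ i ∈ (π[j]'hj).rule.premises, ∀ (hi : i < (π.take j).length),
            ∃ t ∈ ((π.take j)[i]'hi).dnf, SatBy (ext ρ q) t) → False := by
        intro q hq hpq hsat
        have hD : dnfEval (total (ext ρ q)) (π[j]'hj).dnf :=
          dnfEval_of_justifies_local hjust hinit fun i hi hi' => by
            obtain ⟨t, ht, hts⟩ := hsat i hi hi'
            exact ⟨t, ht, termEval_total_of_satBy hts⟩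
        exact not_dnfEval_total (fun t ht htc => (hfals t ht htc).mono (hq.extends_of_subset hpq)) hD
      -- the premises, by rule
      have hp2 : 2 * H ≤ 3 * H := by omega
      cases hrule : (π[j]'hj).rule with
      | initial => exact absurd hrule hinit
      | cut i i' | andIntro i i' =>
        all_goals
          rw [hrule] at hjust hsound
          obtain ⟨hi, hi', -⟩ := hjust
          obtain ⟨Zi, Evi⟩ := hprem i hi
          obtain ⟨Zi', Evi'⟩ := hprem i' hi'
          refine walk Fax ρ _ H (3 * H) (2 * H) hp2 Zi hp ?_ (Finset.empty_subset p) (by simp)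
            (by omega) Evi
          intro q hq hpq hqB hsat
          refine walk Fax ρ _ H (3 * H) (3 * H) le_rfl Zi' hq ?_ (Finset.empty_subset q) (by simp)
            (by omega) Evi'
          intro q' hq' hqq' _ hsat'
          exact (hsound q' hq' (hpq.trans hqq') fun i₀ hi₀ hi₀' => by
            simp only [ResKRule.premises, List.mem_cons, List.not_mem_nil, or_false] at hi₀
            rcases hi₀ with rfl | rfl
            · obtain ⟨t, ht, hts⟩ := hsat
              exact ⟨t, ht, hts.mono (hq'.extends_of_subset hqq')⟩
            · exact hsat').elim
      | andElim i | weaken i =>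
        all_goals
          rw [hrule] at hjust hsound
          obtain ⟨hi, -⟩ := hjust
          obtain ⟨Zi, Evi⟩ := hprem i hi
          refine walk Fax ρ _ H (3 * H) (2 * H) hp2 Zi hp ?_ (Finset.empty_subset p) (by simp)
            (by omega) Evi
          intro q hq hpq _ hsat
          exact (hsound q hq hpq fun i₀ hi₀ hi₀' => by
            simp only [ResKRule.premises, List.mem_cons, List.not_mem_nil, or_false] at hi₀
            subst hi₀
            exact hsat).elim

/-- **Shallow strong trees for all lines give a narrow refutation of the restricted CNF.** If
`π` is an `R(k)`-refutation of `φ` and under `ρ` every line has a strong decision tree of height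
`≤ H`, then the empty clause is derivable from `φ|ρ` in width `3H`.
[Segerlind–Buss–Impagliazzo 2004, §5, Thm. 5.1] [cite: SegerlindBussImpagliazzo2004, Thm 5.1] -/
theorem resDerivable_empty_of_forall_ev {k : ℕ} {φ : CNF ℕ} {π : List (ResKLine ℕ)}
    (hπ : IsResKRefutation k φ π) (ρ : ℕ → Option Bool) {H : ℕ} (hev : ∀ L ∈ π, Ev L.dnf ρ H) :
    ResDerivable (restrictFormula ρ (clauseSet φ)) (3 * H) ∅ := by
  obtain ⟨hder, L, hL, hLe⟩ := hπ
  obtain ⟨j, hj, rfl⟩ := List.getElem_of_mem hL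
  have := pathClause_derivable hder ρ hev j hj ∅ (isPath_empty ρ) (by simp)
    (fun t ht => by rw [hLe] at ht; simp at ht)
  simpa [negPath] using this

end Summit.PneNP.PneNP.Theorems.ResKRestriction
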